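import Summits.ValiantsHypothesis.ValiantsHypothesis.Theorems.BarrierLeverDefinableEquationsUnipotentWeyl
import Summits.ValiantsHypothesis.ValiantsHypothesis.Theorems.BarrierLeverDefinableEquationsHighestWeightVectorTop

/-!
# Crux `BarrierLever.DefinableEquations` (stmt-ValiantsHypothesis-8745) / `SingleSizeEquations`
# (8749) — DOMINANCE: the highest-weight-vector witness has a PARTITION as weight

Completes the normal-form programme (design memo `HWV-NORMAL-FORM-PLAN.md`; the memo marked this
step "AVOID — sl_2-strings"; it is done here with the Weyl element instead).

THEOREM (`weight_le_of_elemU_invariant`).  A nonzero torus weight vector `E` of weight `w` in the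
coefficient variables which is invariant under `e_ij(1) : x_j ↦ x_j + x_i` (`i ≠ j`) has
`w_i ≤ w_j`.  PROOF.  Put `f = e_ji(-1)` and `E_f(c) = E(T_f c)`, `R(c) = E_f(T_{e_ij(1)} c)`.  By
`e_ij`-invariance and the factorisation `w₀ = e_ij(1) f e_ij(1)` of the Weyl element,
`R(c) = E(T_{w₀} c)`; since `w₀` swaps the `i`-th and `j`-th tori, `R` is `i`-isobaric of weight
`w_j`.  The substitution defining `R` from `E_f` is unitriangular for the `i`-grading, so the top
`i`-component of `R` is the top `i`-component of `E_f` (leading-form lemma) — nonzero, hence of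
weight `w_j`; and the substitution defining `E_f` from `E` is unitriangular for the `j`-grading, so
the monomials of `E` (all of `j`-weight `w_j`, `i`-weight `w_i`) survive in `E_f`, whence the top
`i`-weight of `E_f` is `≥ w_i`.  So `w_i ≤ w_j`.  COROLLARIES: `weight_monotone_of_uInvariant` (a
`U`-invariant weight vector has `w_0 ≤ ⋯ ≤ w_{n-1}`), and the final normal form
**`definableEquations_iff_highestWeightVectorDominant`** / **`singleSizeEquations_iff_…`**: the
crux / the item ⟺ for one level `a` and every `b`, eventually in `n`, a nonzero level-`a` Boolean
sum vanishing on `coeff(SmallCircuits ℂ n b)` which is top-supported, a torus weight vector of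
weight `(d; w)` with `Σ w_i = n d` and `w` monotone (`λ = (w_{n-1}, …, w_0) ⊢ n d` a partition with
`≤ n` parts), and `U_n`-invariant: a VNP(N)-explicit highest weight vector of weight `λ` of
`Sym^d(Sym^n ℂ^n)^*`.

HONEST FRAMING.  A normal form; the open content of the crux (Chatterjee–Tengse 2023 §1.3 dir. 2),
8746, 14610 and VP vs VNP are untouched.  No definitions, no named facts.  References:
[LandsbergGCT2017] §8; [KadishLandsberg2014]; [ForbesShpilkaVolk2018] Def. 1.
-/

-- layout Summits/ValiantsHypothesis/ValiantsHypothesis forces the duplicated namespace component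
set_option linter.dupNamespace false

noncomputable section

open MvPolynomial

namespace Summit.ValiantsHypothesis.ValiantsHypothesis.Theorems.BarrierLever.IsobaricEquations

open Literature.Computability.AlgebraicComplexity Literature.Barriers.ValiantsHypothesis
open Summit.ValiantsHypothesis.ValiantsHypothesis.Theorems.BarrierLever.SuccinctHittingSetsForVP
open Summit.ValiantsHypothesis.ValiantsHypothesis.Theorems.BarrierLever.BoolSumComponents

/-! ## §16 The dominance theorem -/

section dominance2

variable {n : ℕ}

/-- `unip` with a single nonzero entry `s_ij = τ` (`i < j`) is the elementary unipotent `e_ij(τ)`.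
[folklore] -/
theorem unip_single {i j : Fin n} (hij : i < j) (τ : ℂ) :
    unip (fun a b => if a = i ∧ b = j then τ else 0) = elemU i j τ := by
  classical
  funext k
  rw [unip_apply, elemU_apply]
  by_cases hk : k = j
  · subst hk
    rw [if_pos rfl, Finset.sum_eq_single i]
    · rw [if_pos ⟨rfl, rfl⟩]
    · intro a _ ha; rw [if_neg (fun h => ha h.1), map_zero, zero_mul]
    · intro h; exact (h (Finset.mem_filter.mpr ⟨Finset.mem_univ _, hij⟩)).elim
  · rw [if_neg hk, Finset.sum_eq_zero, add_zero]
    intro a _; rw [if_neg (fun h => hk h.2), map_zero, zero_mul]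

variable [Fintype (degLEMonomials n)]

/-- **Dominance.**  A nonzero torus weight vector `E` of weight `w` in the coefficient variables
which is invariant under the elementary unipotent `e_ij(1) : x_j ↦ x_j + x_i` (`i ≠ j`) has
`w_i ≤ w_j`.  Proof: with `f = e_ji(-1)`, the Weyl element `w₀ = e_ij(1) f e_ij(1)` swaps the
`i`-th and `j`-th coordinate tori, so `c ↦ E(T_f(T_{e_ij(1)} c)) = E(T_{w₀} c)` is `i`-isobaric of
weight `w_j`; it is the image of `E_f : c ↦ E(T_f c)` under a substitution unitriangular for the
`i`-grading, so its top `i`-component is that of `E_f`, whose `i`-weights reach `w_i` (the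
substitution defining `E_f` is unitriangular for the `j`-grading, so the monomials of `E` survive).
[cite: LandsbergGCT2017, §8] -/
theorem weight_le_of_elemU_invariant {E : MvPolynomial (degLEMonomials n) ℂ} (hE : E ≠ 0)
    {i j : Fin n} (hij : i ≠ j) {w : Fin n → ℕ}
    (hiso : ∀ l : Fin n, IsWeightedHomogeneous (fun m : degLEMonomials n => (m : Fin n →₀ ℕ) l) E (w l))
    (hinv : ∀ c : degLEMonomials n → ℂ, eval (sAct (elemU i j 1) c) E = eval c E) : w i ≤ w j := by
  classical
  -- `R(c) = E(T_{w₀} c)`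
  have hR : ∀ c : degLEMonomials n → ℂ,
      eval c (aeval (elemSubst i j 1) (aeval (elemSubst j i (-1)) E)) =
        eval (sAct (fun k => if k = j then X i else if k = i then -X j else X k) c) E := by
    intro c
    rw [eval_aeval_elemSubst hij, eval_aeval_elemSubst (Ne.symm hij),
      ← hinv (sAct (elemU j i (-1)) (sAct (elemU i j 1) c)), sAct_weyl hij]
  -- `R` is `i`-isobaric of weight `w_j`
  have hRiso : IsWeightedHomogeneous (fun m : degLEMonomials n => (m : Fin n →₀ ℕ) i)
      (aeval (elemSubst i j 1) (aeval (elemSubst j i (-1)) E)) (w j) := by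
    refine isWeightedHomogeneous_of_torus _ fun t c => ?_
    rw [hR, hR]
    show eval (sAct _ (fun m : degLEMonomials n => t ^ ((m : Fin n →₀ ℕ) i) * c m)) E = _
    rw [sAct_weyl_torus hij t c]
    exact Isobaric.eval_torus_of_isWeightedHomogeneous
      (fun m : degLEMonomials n => (m : Fin n →₀ ℕ) j) _ t (hiso j)
  -- a monomial of `E` survives in `E_f`
  obtain ⟨α, hα⟩ := Finset.nonempty_iff_ne_empty.2 (support_eq_empty.not.2 hE)
  have hαf : α ∈ (aeval (elemSubst j i (-1)) E).support := by
    rw [mem_support_iff]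
    have hsub : coeff α (aeval (elemSubst j i (-1)) E - E) = 0 := by
      by_contra hne
      obtain ⟨β, hβ, hlt⟩ := lower_aeval_unitri_sub (fun m : degLEMonomials n => (m : Fin n →₀ ℕ) j)
        (Φ := elemSubst j i (-1)) (fun m => elemSubst_unitri (Ne.symm hij) (-1) m) E α
        (mem_support_iff.mpr hne)
      have h1 : Finsupp.weight (fun m : degLEMonomials n => (m : Fin n →₀ ℕ) j) α = w j :=
        hiso j (mem_support_iff.mp hα)
      have h2 : Finsupp.weight (fun m : degLEMonomials n => (m : Fin n →₀ ℕ) j) β = w j :=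
        hiso j (mem_support_iff.mp hβ)
      omega
    rw [coeff_sub, sub_eq_zero] at hsub
    rw [hsub]; exact mem_support_iff.mp hα
  -- `w_i ≤ D := top i-weight of E_f`
  have hDge : w i ≤ weightedTotalDegree (fun m : degLEMonomials n => (m : Fin n →₀ ℕ) i)
      (aeval (elemSubst j i (-1)) E) := by
    have := le_weightedTotalDegree (fun m : degLEMonomials n => (m : Fin n →₀ ℕ) i) hαf
    rwa [show Finsupp.weight (fun m : degLEMonomials n => (m : Fin n →₀ ℕ) i) α = w i from
      hiso i (mem_support_iff.mp hα)] at this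
  -- the top `i`-component of `R` is that of `E_f`, nonzero; `R` is isobaric of weight `w_j`
  have hEf : aeval (elemSubst j i (-1)) E ≠ 0 := ne_zero_iff.mpr ⟨α, mem_support_iff.mp hαf⟩
  have htop : weightedHomogeneousComponent (fun m : degLEMonomials n => (m : Fin n →₀ ℕ) i)
      (weightedTotalDegree (fun m : degLEMonomials n => (m : Fin n →₀ ℕ) i) (aeval (elemSubst j i (-1)) E))
      (aeval (elemSubst i j 1) (aeval (elemSubst j i (-1)) E)) ≠ 0 := by
    rw [weightedHomogeneousComponent_aeval_unitri _ (Φ := elemSubst i j 1)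
      (fun m => elemSubst_unitri hij 1 m) _ _ (fun β hβ => le_weightedTotalDegree _ hβ)]
    exact weightedHomogeneousComponent_top_ne_zero _ hEf
  have hDeq : weightedTotalDegree (fun m : degLEMonomials n => (m : Fin n →₀ ℕ) i)
      (aeval (elemSubst j i (-1)) E) = w j := by
    by_contra hne
    exact htop (hRiso.weightedHomogeneousComponent_ne _ hne)
  omega

/-- **A `U`-invariant torus weight vector has monotone weight**: `w_0 ≤ w_1 ≤ … ≤ w_{n-1}`, i.e.
`λ = (w_{n-1}, …, w_0)` is a partition (dominance for the upper unitriangular `U`).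
[cite: LandsbergGCT2017, §8] -/
theorem weight_monotone_of_uInvariant {E : MvPolynomial (degLEMonomials n) ℂ} (hE : E ≠ 0)
    {w : Fin n → ℕ}
    (hiso : ∀ l : Fin n, IsWeightedHomogeneous (fun m : degLEMonomials n => (m : Fin n →₀ ℕ) l) E (w l))
    (hU : ∀ (t : Fin n → Fin n → ℂ) (c : degLEMonomials n → ℂ), eval (uAct t c) E = eval c E) :
    Monotone w := by
  intro i j hij
  rcases lt_or_eq_of_le hij with hlt | heq
  · refine weight_le_of_elemU_invariant hE (Fin.ne_of_lt hlt) hiso fun c => ?_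
    have h := hU (fun a b => if a = i ∧ b = j then (1 : ℂ) else 0) c
    rwa [uAct, unip_single hlt] at h
  · rw [heq]

/-- The same from the substitution form of `U`-invariance. [folklore] -/
theorem weight_monotone_of_unipInvariant {E : MvPolynomial (degLEMonomials n) ℂ} (hE : E ≠ 0)
    {w : Fin n → ℕ}
    (hiso : ∀ l : Fin n, IsWeightedHomogeneous (fun m : degLEMonomials n => (m : Fin n →₀ ℕ) l) E (w l))
    (hU : ∀ (t : Fin n → Fin n → ℂ) (f : MvPolynomial (Fin n) ℂ), f.totalDegree ≤ n →
      eval (coeffVector (degLEMonomials n) (aeval (unip t) f)) E =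
        eval (coeffVector (degLEMonomials n) f) E) :
    Monotone w :=
  weight_monotone_of_uInvariant hE hiso fun t c => by
    have h := hU t (ofCoeffs c) (totalDegree_ofCoeffs_le c)
    rwa [coeffVector_ofCoeffs] at h

end dominance2

/-! ## §17 The crux and the support item: dominant highest weight vectors -/

section final

/-- **`DefinableEquations` as VNP(N)-explicit highest weight vectors with DOMINANT weight.**  The
crux holds iff for ONE level `a` and EVERY `b`, eventually in `n`, some nonzero level-`a` Boolean-sum
equation against `SmallCircuits ℂ n b` is top-supported, a torus weight vector of weight `(d; w)`
with `Σ_i w_i = n d` and `w_0 ≤ w_1 ≤ ⋯ ≤ w_{n-1}` (so `λ = (w_{n-1}, …, w_0) ⊢ n d` is a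
partition), and invariant under the unipotent radical — a highest weight vector of weight `λ` of
`Sym^d(Sym^n ℂ^n)^*`. [cite: LandsbergGCT2017, §8] -/
theorem definableEquations_iff_highestWeightVectorDominant :
    Summit.ValiantsHypothesis.ValiantsHypothesis.Theses.BarrierLever.DefinableEquations ↔
      ∃ a : ℕ, ∀ b : ℕ, ∃ n₀ : ℕ, ∀ n ≥ n₀, ∃ q : ℕ, q ≤ (Nat.choose (2 * n) n) ^ a ∧
        ∃ H : MvPolynomial (↥(degLEMonomials n) ⊕ Fin q) ℂ,
          complexity H ≤ (Nat.choose (2 * n) n) ^ a ∧ H.totalDegree ≤ (Nat.choose (2 * n) n) ^ a ∧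
          boolSum H ≠ 0 ∧
          (∀ f ∈ SmallCircuits ℂ n b, eval (coeffVector (degLEMonomials n) f) (boolSum H) = 0) ∧
          (∀ α ∈ (boolSum H).support, ∀ m ∈ α.support,
            ((m : degLEMonomials n) : Fin n →₀ ℕ).degree = n) ∧
          (∃ (d : ℕ) (w : Fin n → ℕ), (boolSum H).IsHomogeneous d ∧
            (∀ i : Fin n, IsWeightedHomogeneous
              (fun m : degLEMonomials n => (m : Fin n →₀ ℕ) i) (boolSum H) (w i)) ∧
            ∑ i, w i = n * d ∧ Monotone w) ∧
          ∀ (t : Fin n → Fin n → ℂ) (f : MvPolynomial (Fin n) ℂ), f.totalDegree ≤ n →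
            eval (coeffVector (degLEMonomials n) (aeval (unip t) f)) (boolSum H) =
              eval (coeffVector (degLEMonomials n) f) (boolSum H) := by
  rw [definableEquations_iff_highestWeightVectorTop]
  constructor
  · rintro ⟨a, h⟩
    refine ⟨a, fun b => ?_⟩
    obtain ⟨n₀, hn₀⟩ := h b
    refine ⟨n₀, fun n hn => ?_⟩
    obtain ⟨q, hq, H, hc, hd, hne, hvan, htop, ⟨d, w, hhom, hiso, hsum⟩, hinv⟩ := hn₀ n hn
    haveI : Fintype (degLEMonomials n) := (Finsupp.finite_of_degree_le (σ := Fin n) n).fintype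
    exact ⟨q, hq, H, hc, hd, hne, hvan, htop,
      ⟨d, w, hhom, hiso, hsum, weight_monotone_of_unipInvariant hne hiso hinv⟩, hinv⟩
  · rintro ⟨a, h⟩
    refine ⟨a, fun b => ?_⟩
    obtain ⟨n₀, hn₀⟩ := h b
    refine ⟨n₀, fun n hn => ?_⟩
    obtain ⟨q, hq, H, hc, hd, hne, hvan, htop, ⟨d, w, hhom, hiso, hsum, -⟩, hinv⟩ := hn₀ n hn
    exact ⟨q, hq, H, hc, hd, hne, hvan, htop, ⟨d, w, hhom, hiso, hsum⟩, hinv⟩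

/-- **`SingleSizeEquations` as VNP(N)-explicit highest weight vectors with dominant weight**
(the `∀ b ∃ a` item, stmt-ValiantsHypothesis-8749). [cite: LandsbergGCT2017, §8] -/
theorem singleSizeEquations_iff_highestWeightVectorDominant :
    Summit.ValiantsHypothesis.ValiantsHypothesis.Theses.BarrierLever.SingleSizeEquations ↔
      ∀ b : ℕ, ∃ a n₀ : ℕ, ∀ n ≥ n₀, ∃ q : ℕ, q ≤ (Nat.choose (2 * n) n) ^ a ∧
        ∃ H : MvPolynomial (↥(degLEMonomials n) ⊕ Fin q) ℂ,
          complexity H ≤ (Nat.choose (2 * n) n) ^ a ∧ H.totalDegree ≤ (Nat.choose (2 * n) n) ^ a ∧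
          boolSum H ≠ 0 ∧
          (∀ f ∈ SmallCircuits ℂ n b, eval (coeffVector (degLEMonomials n) f) (boolSum H) = 0) ∧
          (∀ α ∈ (boolSum H).support, ∀ m ∈ α.support,
            ((m : degLEMonomials n) : Fin n →₀ ℕ).degree = n) ∧
          (∃ (d : ℕ) (w : Fin n → ℕ), (boolSum H).IsHomogeneous d ∧
            (∀ i : Fin n, IsWeightedHomogeneous
              (fun m : degLEMonomials n => (m : Fin n →₀ ℕ) i) (boolSum H) (w i)) ∧
            ∑ i, w i = n * d ∧ Monotone w) ∧
          ∀ (t : Fin n → Fin n → ℂ) (f : MvPolynomial (Fin n) ℂ), f.totalDegree ≤ n →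
            eval (coeffVector (degLEMonomials n) (aeval (unip t) f)) (boolSum H) =
              eval (coeffVector (degLEMonomials n) f) (boolSum H) := by
  rw [singleSizeEquations_iff_highestWeightVectorTop]
  constructor
  · intro h b
    obtain ⟨a, n₀, hn₀⟩ := h b
    refine ⟨a, n₀, fun n hn => ?_⟩
    obtain ⟨q, hq, H, hc, hd, hne, hvan, htop, ⟨d, w, hhom, hiso, hsum⟩, hinv⟩ := hn₀ n hn
    haveI : Fintype (degLEMonomials n) := (Finsupp.finite_of_degree_le (σ := Fin n) n).fintype
    exact ⟨q, hq, H, hc, hd, hne, hvan, htop,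
      ⟨d, w, hhom, hiso, hsum, weight_monotone_of_unipInvariant hne hiso hinv⟩, hinv⟩
  · intro h b
    obtain ⟨a, n₀, hn₀⟩ := h b
    refine ⟨a, n₀, fun n hn => ?_⟩
    obtain ⟨q, hq, H, hc, hd, hne, hvan, htop, ⟨d, w, hhom, hiso, hsum, -⟩, hinv⟩ := hn₀ n hn
    exact ⟨q, hq, H, hc, hd, hne, hvan, htop, ⟨d, w, hhom, hiso, hsum⟩, hinv⟩

end final

end Summit.ValiantsHypothesis.ValiantsHypothesis.Theorems.BarrierLever.IsobaricEquations

end
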